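import Mathlib
import HarnessLib
import Summits.AtomisticToContinuum.FouriersLaw.Theses.PhononMeanFreePath

/-!
# `PhononMeanFreePath.Assembly` — proved

Item `stmt-AtomisticToContinuum-11817` (assembly, route `PhononMeanFreePath`, sub-problem `FouriersLaw`):
`NessUnique → BoundaryKubo → CoherentDephasing → IncoherentChannel → FouriersLaw`.

The assembly is, hypothesis for hypothesis, the type of the route's gate-certified deciding theorem
`Summit.AtomisticToContinuum.FouriersLaw.Theses.PhononMeanFreePath.closes` (D-0027 §2.1): clause (i)
of `FouriersLawFor` from the proved existence fact `pinnedChain_exists_isSteadyState` plus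
`NessUnique`; `κ T` the witness of `IncoherentChannel`; `D 0 = 0` (`totalCurrent_zero`) and
`D (N+1) = N (γ²/T²) ∫ C_N` from `BoundaryKubo`; the split `∫ C_N = ∫ (C_N - 2 r_N²) + 2 ∫ r_N²`
(`integral_sub`) sends `D (N+1) → κ T + 0` by `CoherentDephasing`. So the item closes by `closes`.
-/

namespace Summit.AtomisticToContinuum.FouriersLaw.Theorems

/-- The assembly of route `PhononMeanFreePath`:
`NessUnique → BoundaryKubo → CoherentDephasing → IncoherentChannel → FouriersLaw`,
discharged by the route's deciding theorem `PhononMeanFreePath.closes`. -/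
theorem phononMeanFreePath_assembly_proof :
    Summit.AtomisticToContinuum.FouriersLaw.Theses.PhononMeanFreePath.Assembly := by
  unfold Summit.AtomisticToContinuum.FouriersLaw.Theses.PhononMeanFreePath.Assembly
  exact Summit.AtomisticToContinuum.FouriersLaw.Theses.PhononMeanFreePath.closes

end Summit.AtomisticToContinuum.FouriersLaw.Theorems
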